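import Literature.NumberTheory.PAdicHodge.KatoH1BdRFilHolds
import Literature.NumberTheory.GaloisRepresentations.PAdicHodgeProofs
import Literature.NumberTheory.GaloisRepresentations.PotentialDiagonalizabilityCriteriaProofs
import Literature.NumberTheory.GaloisRepresentations.GaloisCohomology
import Literature.NumberTheory.AdelicBaseChange.ModuleTopologyToolkit
import HarnessLib

/-!
# Dévissage for `B`-admissibility with a trivial quotient: extensions of `ℚ_p^k` by a de Rham `V`
# with `D⁰_dR(V) = 0` are de Rham (Bloch–Kato 1990, Cor. 3.8.4 / Ex. 3.9 shape: `H¹_g = H¹`)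

Topic `NumberTheory/PAdicHodge`; theorems only (no definition, no named fact, no instance).

Let `𝔅` be a period-ring datum of the tree (`PeriodRingData Γ P E`: a regular `(P, Γ)`-ring `B` with
`B^Γ = E`), `ρ` a continuous `P`-linear representation of `Γ` on a finite-dimensional `M`, and `N ≤ M` a
`Γ`-stable subspace on whose quotient `Γ` acts TRIVIALLY (`ρ σ m − m ∈ N`). The **abstract dévissage**
`PeriodRingData.isAdmissible_of_subrepresentation_of_trivial_quotient`: if the subrepresentation `ρ|_N` is
`𝔅`-admissible and, for every `m ∈ M`, the `N`-valued crossed homomorphism `σ ↦ ρ σ m − m` becomes a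
coboundary in `B ⊗_P N` (`1 ⊗ (ρ σ m − m) = σ b − b`), then `ρ` is `𝔅`-admissible. Proof: the invariants
`D(ρ|_N) ↪ D(ρ)` (flatness over the field `P`), and each lift `m_i` of a basis of `M ⧸ N` gives the invariant
`1 ⊗ m_i − b_i`, whose images `1 ⊗ m̄_i` in `B ⊗_P (M ⧸ N)` are `B`-, hence `E`-linearly independent; so
`dim_E D(ρ) ≥ dim N + dim M⧸N = dim M`, and Fontaine's inequality (`finrank_D_le_holds`; finiteness `finite_D`) gives equality.

The **genuine corollary** for Fontaine's `B_dR(F)` (`bdRPeriodRingData hp`, any `p`-adic field `F`, any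
`ℚ_p`-algebra structure on it), `isDeRham_of_subrepresentation_of_trivial_quotient`: if `ρ|_N` is de Rham with
`Fil⁰ D_dR(ρ|_N) = 0`, then `ρ` is de Rham. Indeed Kato's Prop. 1.2.3 (surjectivity half, the tree THEOREM
`cupLogInjective_and_hasDualExp_of_isDeRham_holds`) writes `[1 ⊗ z] = x ∪ log χ_cyclo` in
`H¹(F, B_dR⁺ ⊗ N)` with `x ∈ D⁰_dR(N) = 0` for every continuous crossed homomorphism `z : Γ_F → N`, i.e.
the map `H¹(F, N) → H¹(F, B_dR⁺ ⊗ N)` vanishes — Bloch–Kato's `H¹_g(F, N) = H¹(F, N)` when `D⁰_dR(N) = 0`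
(Cor. 3.8.4: `dim H¹_f(V) = dim D_dR(V)/D⁰_dR(V) + dim H⁰(V)`; Ex. 3.9: `H¹_g(K, ℚ_p(1)) = H¹(K, ℚ_p(1))`),
in the form "every extension of the trivial representation by `N` is de Rham".

Motivation (BSD cell `bsd-wall`, route `EdixhovenFibreFiveSeven`, crux K★ `stmt-BirchSwinnertonDyer-22226`,
stub hDR `isDeRham_restrictedRationalTateRep`): the potentially ORDINARY and potentially MULTIPLICATIVE sectors
of "`V_pE` is de Rham" are extensions of an unramified character by an unramified twist of `ℚ_p(1)` (Tate
curve; connected–étale sequence), de Rham by this dévissage after an unramified twist; no `B_cris`, no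
explicit periods of `E` are needed there.

## References

* [BlochKato1990] S. Bloch, K. Kato, *L-functions and Tamagawa numbers of motives*, Grothendieck Festschrift
  I (1990), Cor. 3.8.4, Example 3.9 (p. 359).
* [Kato1993LNM1553] K. Kato, LNM 1553 (1993), Ch. II Prop. 1.2.3, §1.2.4.
* [FontaineAsterisque223III] J.-M. Fontaine, Astérisque 223 (1994), Exp. III §1.5 (Prop. 1.5.2).
-/

noncomputable section

open scoped TensorProduct
open TensorProduct

universe u v v' w w'

namespace Literature.NumberTheory.GaloisRepresentations.PeriodRingData

-- Mathlib's own global value; see the implementation note of `PAdicHodgeProofs.lean` (nested instance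
-- problems on `𝔅.B ⊗[P] M` fail spuriously under the core default).
set_option maxSynthPendingDepth 3

variable {Γ : Type u} [Group Γ] [TopologicalSpace Γ] {P : Type v} {E : Type v'} [Field P]
  [TopologicalSpace P] [Field E] [Algebra P E]
  {M : Type w'} [AddCommGroup M] [Module P M] [TopologicalSpace M]
  (𝔅 : PeriodRingData.{u, v, v', w} Γ P E) (ρ : ContinuousRep Γ P M)

/-! ### `B ⊗ N → B ⊗ M` for a stable subspace `N` -/

/-- The diagonal action commutes with `B ⊗ N → B ⊗ M` for a `Γ`-stable subspace `N` (functoriality of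
`V ↦ B ⊗_P V` in the `B`-representation, Fontaine Exp. III §1.3). [cite: FontaineAsterisque223III, Exp. III §1.3] -/
theorem map_subtype_tensorRep (N : Submodule P M) (hN : ∀ g : Γ, N ≤ N.comap (ρ g)) (σ : Γ)
    (x : 𝔅.B ⊗[P] N) :
    AlgebraTensorModule.map (LinearMap.id : 𝔅.B →ₗ[E] 𝔅.B) N.subtype
        (𝔅.tensorRep (ρ.subrepresentation N hN) σ x) =
      𝔅.tensorRep ρ σ (AlgebraTensorModule.map (LinearMap.id : 𝔅.B →ₗ[E] 𝔅.B) N.subtype x) := by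
  induction x using TensorProduct.induction_on with
  | zero => simp
  | tmul b n => simp
  | add x y hx hy => simp [map_add, hx, hy]

/-- `B ⊗ N → B ⊗ M` maps `D(ρ|_N)` into `D(ρ)` (functoriality of `D_B`, Fontaine Exp. III §1.3).
[cite: FontaineAsterisque223III, Exp. III §1.3] -/
theorem map_subtype_mem_D (N : Submodule P M) (hN : ∀ g : Γ, N ≤ N.comap (ρ g))
    {x : 𝔅.B ⊗[P] N} (hx : x ∈ 𝔅.D (ρ.subrepresentation N hN)) :
    AlgebraTensorModule.map (LinearMap.id : 𝔅.B →ₗ[E] 𝔅.B) N.subtype x ∈ 𝔅.D ρ := by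
  rw [mem_D_iff] at hx ⊢
  intro σ
  rw [← 𝔅.map_subtype_tensorRep ρ N hN σ x, hx σ]

omit [TopologicalSpace Γ] [TopologicalSpace P] [TopologicalSpace M] in
/-- `B ⊗ N → B ⊗ M` is injective (`B` is flat over the field `P`). [folklore] -/
private theorem map_subtype_injective (N : Submodule P M) :
    Function.Injective (AlgebraTensorModule.map (LinearMap.id : 𝔅.B →ₗ[E] 𝔅.B) N.subtype) := by
  have h : Function.Injective (N.subtype.lTensor 𝔅.B) :=
    Module.Flat.lTensor_preserves_injective_linearMap _ N.injective_subtype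
  have heq : ∀ x : 𝔅.B ⊗[P] N,
      AlgebraTensorModule.map (LinearMap.id : 𝔅.B →ₗ[E] 𝔅.B) N.subtype x = N.subtype.lTensor 𝔅.B x := by
    intro x
    induction x using TensorProduct.induction_on with
    | zero => simp
    | tmul b n => simp
    | add x y hx hy => simp [map_add, hx, hy]
  intro x y hxy
  exact h (by rw [← heq, ← heq, hxy])

omit [TopologicalSpace Γ] [TopologicalSpace P] [TopologicalSpace M] in
/-- `B ⊗ N → B ⊗ M → B ⊗ (M ⧸ N)` is zero. [folklore] -/
private theorem map_mkQ_map_subtype (N : Submodule P M) (x : 𝔅.B ⊗[P] N) :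
    AlgebraTensorModule.map (LinearMap.id : 𝔅.B →ₗ[E] 𝔅.B) N.mkQ
      (AlgebraTensorModule.map (LinearMap.id : 𝔅.B →ₗ[E] 𝔅.B) N.subtype x) = 0 := by
  induction x using TensorProduct.induction_on with
  | zero => simp
  | tmul b n =>
    rw [AlgebraTensorModule.map_tmul, AlgebraTensorModule.map_tmul, LinearMap.id_apply,
      LinearMap.id_apply, Submodule.subtype_apply, Submodule.mkQ_apply,
      (Submodule.Quotient.mk_eq_zero N).2 n.2, tmul_zero]
  | add x y hx hy => simp [map_add, hx, hy]

/-! ### The dévissage -/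

/-- **Dévissage for admissibility, trivial quotient.** Let `N ≤ M` be `Γ`-stable with `Γ` acting trivially
on `M ⧸ N`. If `ρ|_N` is `𝔅`-admissible and every crossed homomorphism `σ ↦ ρ σ m − m` (`m ∈ M`) becomes a
coboundary in `B ⊗_P N`, then `ρ` is `𝔅`-admissible. (For `B_dR` and `D⁰_dR(N) = 0` the coboundary
hypothesis is Kato II Prop. 1.2.3; Bloch–Kato Cor. 3.8.4 / Ex. 3.9.)
[cite: BlochKato1990, Cor. 3.8.4 and Example 3.9] [cite: FontaineAsterisque223III, Prop. 1.5.2] -/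
theorem isAdmissible_of_subrepresentation_of_trivial_quotient [FiniteDimensional P M]
    (N : Submodule P M) (hN : ∀ g : Γ, N ≤ N.comap (ρ g))
    (htriv : ∀ (g : Γ) (m : M), ρ g m - m ∈ N)
    (hadm : 𝔅.IsAdmissible (ρ.subrepresentation N hN))
    (hcob : ∀ m : M, ∃ b : 𝔅.B ⊗[P] N, ∀ σ : Γ,
      (1 : 𝔅.B) ⊗ₜ[P] (⟨ρ σ m - m, htriv σ m⟩ : N) =
        𝔅.tensorRep (ρ.subrepresentation N hN) σ b - b) :
    𝔅.IsAdmissible ρ := by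
  classical
  haveI : Module.Finite E (𝔅.D ρ) := 𝔅.finite_D ρ
  set ρN := ρ.subrepresentation N hN with hρN
  -- the two maps
  set ι : 𝔅.B ⊗[P] N →ₗ[E] 𝔅.B ⊗[P] M :=
    AlgebraTensorModule.map (LinearMap.id : 𝔅.B →ₗ[E] 𝔅.B) N.subtype with hι
  set Φ : 𝔅.B ⊗[P] M →ₗ[E] 𝔅.B ⊗[P] (M ⧸ N) :=
    AlgebraTensorModule.map (LinearMap.id : 𝔅.B →ₗ[E] 𝔅.B) N.mkQ with hΦ
  -- a basis of the quotient, lifts, correcting tensors, and the new invariants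
  let q := Module.finBasis P (M ⧸ N)
  have hlift : ∀ i, ∃ m : M, N.mkQ m = q i := fun i => N.mkQ_surjective (q i)
  choose m hm using hlift
  choose b hb using hcob
  let e : Fin (Module.finrank P (M ⧸ N)) → 𝔅.B ⊗[P] M := fun i => (1 : 𝔅.B) ⊗ₜ[P] m i - ι (b (m i))
  have he : ∀ i, e i ∈ 𝔅.D ρ := by
    intro i
    rw [mem_D_iff]
    intro σ
    simp only [e, map_sub, tensorRep_apply_tmul, smul_one]
    rw [hι, ← 𝔅.map_subtype_tensorRep ρ N hN σ (b (m i)), show 𝔅.tensorRep ρN σ (b (m i)) =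
        (1 : 𝔅.B) ⊗ₜ[P] (⟨ρ σ (m i) - m i, htriv σ (m i)⟩ : N) + b (m i) by
      rw [hb (m i) σ]; abel]
    rw [map_add, AlgebraTensorModule.map_tmul, LinearMap.id_apply, Submodule.subtype_apply,
      tmul_sub]
    abel
  have hΦe : ∀ i, Φ (e i) = (1 : 𝔅.B) ⊗ₜ[P] q i := by
    intro i
    simp only [e, map_sub, hΦ, hι, map_mkQ_map_subtype, sub_zero, AlgebraTensorModule.map_tmul,
      LinearMap.id_apply, hm]
  -- the subspace `S = ι(D(ρ|_N)) + Σ E e_i ≤ D(ρ)`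
  set S : Submodule E (𝔅.B ⊗[P] M) := (𝔅.D ρN).map ι ⊔ Submodule.span E (Set.range e) with hS
  have hSD : S ≤ 𝔅.D ρ := by
    refine sup_le ?_ (Submodule.span_le.mpr ?_)
    · rintro _ ⟨x, hx, rfl⟩
      exact 𝔅.map_subtype_mem_D ρ N hN hx
    · rintro _ ⟨i, rfl⟩
      exact he i
  haveI : FiniteDimensional E S := Submodule.finiteDimensional_of_le hSD
  -- Fontaine's inequality
  refine le_antisymm (𝔅.finrank_D_le_holds ρ) ?_
  -- the count
  have hdim : Module.finrank P (M ⧸ N) + Module.finrank P N = Module.finrank P M :=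
    Submodule.finrank_quotient_add_finrank N
  have hSle : Module.finrank E S ≤ Module.finrank E (𝔅.D ρ) := Submodule.finrank_mono hSD
  -- rank–nullity for `Φ|_S`
  have hrn := (Φ.domRestrict S).finrank_range_add_finrank_ker
  -- (a) the range contains the `E`-independent `1 ⊗ q i`
  have hli : LinearIndependent E (fun i => (1 : 𝔅.B) ⊗ₜ[P] q i) := by
    have hB : LinearIndependent 𝔅.B (fun i => (1 : 𝔅.B) ⊗ₜ[P] q i) := by
      have h := (Algebra.TensorProduct.basis 𝔅.B q).linearIndependent
      have hfun : ⇑(Algebra.TensorProduct.basis 𝔅.B q) = fun i => (1 : 𝔅.B) ⊗ₜ[P] q i :=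
        funext fun i => Algebra.TensorProduct.basis_apply q i
      rwa [hfun] at h
    refine hB.restrict_scalars ?_
    intro r r' hrr'
    have h' : algebraMap E 𝔅.B r = algebraMap E 𝔅.B r' := by
      simpa only [Algebra.smul_def, mul_one] using hrr'
    exact (algebraMap E 𝔅.B).injective h'
  have hrange : Module.finrank P (M ⧸ N) ≤ Module.finrank E (LinearMap.range (Φ.domRestrict S)) := by
    have hsub : Submodule.span E (Set.range fun i => (1 : 𝔅.B) ⊗ₜ[P] q i) ≤
        LinearMap.range (Φ.domRestrict S) := by
      refine Submodule.span_le.mpr ?_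
      rintro _ ⟨i, rfl⟩
      refine ⟨⟨e i, ?_⟩, ?_⟩
      · exact Submodule.mem_sup_right (Submodule.subset_span ⟨i, rfl⟩)
      · rw [LinearMap.domRestrict_apply, hΦe]
    calc Module.finrank P (M ⧸ N)
        = Fintype.card (Fin (Module.finrank P (M ⧸ N))) := (Fintype.card_fin _).symm
      _ = Module.finrank E (Submodule.span E (Set.range fun i => (1 : 𝔅.B) ⊗ₜ[P] q i)) :=
          (finrank_span_eq_card hli).symm
      _ ≤ Module.finrank E (LinearMap.range (Φ.domRestrict S)) := Submodule.finrank_mono hsub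
  -- (b) the kernel contains `ι(D(ρ|_N))`, of dimension `dim N`
  have hker : Module.finrank P N ≤ Module.finrank E (LinearMap.ker (Φ.domRestrict S)) := by
    rw [← hadm]
    let j : 𝔅.D ρN →ₗ[E] LinearMap.ker (Φ.domRestrict S) :=
      { toFun := fun x => ⟨⟨ι x, Submodule.mem_sup_left ⟨x, x.2, rfl⟩⟩, by
          rw [LinearMap.mem_ker, LinearMap.domRestrict_apply]
          exact 𝔅.map_mkQ_map_subtype N x⟩
        map_add' := fun x y => by ext; simp
        map_smul' := fun c x => by ext; simp }
    have hj : Function.Injective j := by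
      intro x y hxy
      have h : ι x = ι y :=
        congrArg (fun z : LinearMap.ker (Φ.domRestrict S) => ((z : S) : 𝔅.B ⊗[P] M)) hxy
      exact Subtype.ext (𝔅.map_subtype_injective N h)
    exact LinearMap.finrank_le_finrank_of_injective hj
  omega

end Literature.NumberTheory.GaloisRepresentations.PeriodRingData

/-! ### The genuine corollary for `B_dR(F)` -/

namespace Literature.NumberTheory.PAdicHodge

open Field ValuativeRel
open Literature.NumberTheory.GaloisRepresentations
open Literature.NumberTheory.GaloisRepresentations.IsNonarchimedeanLocalField

variable {F : Type} [Field F] [ValuativeRel F] [TopologicalSpace F] [IsNonarchimedeanLocalField F]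
  [CharZero F] {p : ℕ} [Fact p.Prime] [Fact (¬ IsUnit (p : integerC F))]
  [IsAdicComplete (Ideal.span {(p : integerC F)}) (integerC F)] (hp : valuation F p < 1) [Algebra ℚ_[p] F]
  {M : Type} [AddCommGroup M] [Module ℚ_[p] M] [TopologicalSpace M] [IsTopologicalAddGroup M]
  [ContinuousSMul ℚ_[p] M] [Module.Finite ℚ_[p] M] [IsModuleTopology ℚ_[p] M]

omit [Module.Finite ℚ_[p] M] in
/-- A subspace of a `ℚ_p`-vector space with the module topology carries the module topology (it is a
linear retract). [folklore] -/
private theorem isModuleTopology_submodule (N : Submodule ℚ_[p] M) : IsModuleTopology ℚ_[p] N := by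
  obtain ⟨π, hπ⟩ := N.subtype.exists_leftInverse_of_injective (Submodule.ker_subtype N)
  refine IsModuleTopology.of_inverse M π (fun x : N => (x : M)) continuous_subtype_val ?_
  intro x
  exact LinearMap.congr_fun hπ x

/-- **Extensions of the trivial representation by a de Rham `V` with `D⁰_dR(V) = 0` are de Rham** (for
Fontaine's `B_dR(F)`, every `p`-adic field `F` and every `ℚ_p`-algebra structure on it): if `N ≤ M` is
`Γ_F`-stable with trivial action on `M ⧸ N`, `ρ|_N` is de Rham and `Fil⁰ D_dR(ρ|_N) = 0`, then `ρ` is de Rham.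
Kato II Prop. 1.2.3 (tree theorem `cupLogInjective_and_hasDualExp_of_isDeRham_holds`) supplies the
coboundaries; Bloch–Kato's `H¹_g = H¹` for such `V`. [cite: BlochKato1990, Cor. 3.8.4 and Example 3.9]
[cite: Kato1993LNM1553, Ch. II Prop. 1.2.3] -/
theorem isDeRham_of_subrepresentation_of_trivial_quotient (ρ : GaloisRep F ℚ_[p] M)
    (N : Submodule ℚ_[p] M) (hN : ∀ g, N ≤ N.comap (ρ g))
    (htriv : ∀ (g : absoluteGaloisGroup F) (m : M), ρ g m - m ∈ N)
    (hdR : GaloisRep.IsDeRham (bdRPeriodRingData (F := F) (p := p) hp) (ρ.subrepresentation N hN))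
    (hfil : (bdRPeriodRingData (F := F) (p := p) hp).filD (ρ.subrepresentation N hN) 0 = ⊥) :
    GaloisRep.IsDeRham (bdRPeriodRingData (F := F) (p := p) hp) ρ := by
  haveI : IsModuleTopology ℚ_[p] N := isModuleTopology_submodule N
  set 𝔅 := bdRPeriodRingData (F := F) (p := p) hp with h𝔅
  set ρN := ρ.subrepresentation N hN with hρN
  refine 𝔅.isAdmissible_of_subrepresentation_of_trivial_quotient ρ N hN htriv hdR fun m => ?_
  -- the continuous crossed homomorphism `σ ↦ ρ σ m - m` with values in `N`
  let z₀ : absoluteGaloisGroup F → N := fun σ => ⟨ρ σ m - m, htriv σ m⟩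
  have hz₀ : Continuous z₀ := ((ρ.continuous_apply_left m).sub continuous_const).subtype_mk _
  have hzmul : ∀ g h, z₀ (g * h) = z₀ g + ρN.toTopRep.ρ g (z₀ h) := by
    intro g h
    apply Subtype.ext
    change ρ (g * h) m - m = (ρ g m - m) + (ρ g (ρ h m - m) : M)
    rw [map_mul, Module.End.mul_apply, map_sub]
    abel
  let z : contOneCocycles ρN.toTopRep := ⟨⟨z₀, hz₀⟩, hzmul⟩
  obtain ⟨x, hxD, hxfil, b, -, hcb⟩ := (cupLogInjective_and_hasDualExp_of_isDeRham_holds hp ρN hdR).2 z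
  have hx0 : x = 0 := by
    have hmem : (⟨x, hxD⟩ : 𝔅.D ρN) ∈ 𝔅.filD ρN 0 := (PeriodRingData.mem_filD_iff 𝔅 ρN 0 _).mpr hxfil
    rw [hfil, Submodule.mem_bot] at hmem
    exact congrArg Subtype.val hmem
  refine ⟨b, fun σ => ?_⟩
  have h := hcb σ
  simp only [hx0, smul_zero, sub_zero] at h
  exact h

end Literature.NumberTheory.PAdicHodge

end
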